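import Summits.CriticalPhenomena.PercolationContinuityZ3.Theorems.PercNearOneGluingNoHeavyLowerTailMixCSHPeelTools
import Summits.CriticalPhenomena.PercolationContinuityZ3.Theorems.PercNearOneGluingNoHeavyLowerTailCSHLemmaT
import Literature.Probability.Percolation.TwoClusterGibbsHubCovariance
import HarnessLib

/-!
# `NoHeavyLowerTail` (stmt-CriticalPhenomena-4575) — MIXED conditioned slack hierarchy (hub observer): LEMMA T
# (the Gibbs-sampler reduction of a mixed CSH margin to its world-wise form)

Support file (`--supports stmt-CriticalPhenomena-4575`), prover `prim-hp-7` (gen 33); brick B1 of prim-ineq-gen-7's Lean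
blueprint for THEOREM M1 (memo `prim-ineq-gen-7/PROOF-Q9-MIXED-CSH.md` §3.1 / §10, write-up `Q9-WRITEUP.md` Lemma 6.1) on the
road MIX-CSH (Theorem M1) ⟹ mixed pre-FKG peeling (Theorem M2, `MixCSH.mixPreMargin_nonneg_of_mixCSH`) ⟹ Kozma–Nitzan
Question 9 for every `|A|` (`MixCSH.kn_question9_of_mixCSH`) ⟹ Conjecture 6 without hypothesis.  No definitions, no named
facts, no sorries.

Lemma T, mixed (memo §3.1): the mixed margin `Marg[u ↦ mixCovD(u)]` of `MixCSH.mixCshMargin` — level form of the mixed decoy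
list and observers' constant, applied to the conditional covariances on `D = {x ↮ Y}` of `f(C_x)` with the tests `1{x ↔ u}`
(`u` a vertex) and, at the hub label `o`, with the HUB TEST `1{Σ ∩ C_x ≠ ∅}·1{Σ ↮ Y}` — is nonnegative for every monotone `f`
as soon as its WORLD-WISE version is nonnegative for every monotone `g ≥ 0`: in the world `ω ∈ D` (weights `w^ω` = `w`
zeroed on the pairs meeting the open vertex cluster of `Y`, vdBHK Lemma 2.4) the entry at a vertex `u` is the pure world
covariance `Cov_{w^ω}(g(C_x), 1{x ↔ u})` and the entry at `o` is `1{Σ ↮ Y}(ω) · Cov_{w^ω}(g(C_x), 1{Σ ↔ x})` (memo's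
`κ_W(o) = 1{Σ ∩ W = ∅}·Cov_{H∖W}(Ψ(C_x), 1{Σ ∩ C_x ≠ ∅})`).  The memo's extra term `X[Ψ] ≥ 0` (Harris for the decreasing
pair `(g(C_Y), 1{Σ ∩ C_Y = ∅})` given `C_x`) is exactly the cross term of the tree's joint-test reduction theorem
`BHK2006_multiMarkerHubCov_nonneg_of_within` (Literature/Probability/Percolation/TwoClusterGibbsHubCovariance), which
absorbs it; what makes it applicable is that the hub entry of `Marg` has coefficient `+1 ≥ 0`
(`MixCSH.cshMarg_single_label`: `o` is not a decoy and `o ≠ v`).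

* `MixCSH.mixCshMargin_nonneg_of_within` — Lemma T, mixed, at fixed weights (`w e < 1` on the non-loop pairs meeting `Y`).
[cite: VandenbergHaggstromKahn2005, §2.1 pp. 10–13, Lemma 2.4 (p. 10)] [cite: KozmaNitzan2024, Question 9 (§5.5 p. 36), Conj. 6 (§5.3 p. 34)]
-/

noncomputable section

namespace Summit.CriticalPhenomena.PercolationContinuityZ3.Theorems

open MeasureTheory Set Literature.Probability.LatticeModels Literature.Probability.Percolation
open scoped Classical

namespace MixCSH

variable {V : Type*} [Fintype V]

/-- **Lemma T for the MIXED conditioned slack hierarchy (fixed weights)** — memo PROOF-Q9-MIXED-CSH.md §3.1 /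
Q9-WRITEUP Lemma 6.1, blueprint brick B1.  Owner `x`, avoided set `Y` with `w e < 1` on the non-loop pairs meeting `Y`,
decoys `D`, hub set `Σ` with label `o` (not a decoy, `o ≠ v`), second observer `v`; `L`, `p` the mixed decoy list and
observers' constant of `MixCSH.mixCshMargin`.  IF for every monotone `g ≥ 0` the WORLD-WISE mixed margin is nonnegative,
`0 ≤ ∫_{x↮Y} Marg_{L,p}[W^ω_g] dμ_w(ω)`, where in the world `ω` (weights `w^ω` = `w` zeroed on the pairs meeting the open
vertex cluster of `Y`) the entry at a vertex `u ≠ o` is the pure world covariance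
`∫_{x↔u} g(C_x) dμ_{w^ω} − (∫ g(C_x) dμ_{w^ω})·μ_{w^ω}(x↔u)` and the entry at the hub label `o` is
`1{Σ ↮ Y}(ω) · [∫_{Σ↔x} g(C_x) dμ_{w^ω} − (∫ g(C_x) dμ_{w^ω})·μ_{w^ω}(Σ↔x)]` (the avoidance factor of the hub test
`1{Σ∩C_x ≠ ∅}·1{Σ ↮ Y}` is frozen in the world, the other factor is a marker of the fresh cluster), THEN
`0 ≤ MixCSH.mixCshMargin w Σ x Y D o v f` for every monotone `f`.  Proof: the hub test is a product of an increasing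
function of `C_x` and a DECREASING function of the cluster of `Y` and enters `Marg` with coefficient `+1`
(`MixCSH.cshMarg_single_label`), so the joint-test reduction theorem `BHK2006_multiMarkerHubCov_nonneg_of_within`
(BHK's two-cluster Gibbs chain; the extra cross term of the `Y`-half-step has the right sign by Harris) applies to the
linear form `Marg`, whose coefficients are read off by `CSH.cshMarg_eq_sum`.
[cite: VandenbergHaggstromKahn2005, §2.1 pp. 10–13, Lemma 2.4 (p. 10)] [cite: KozmaNitzan2024, Question 9 (§5.5 p. 36)] -/
theorem mixCshMargin_nonneg_of_within (w : Sym2 V → unitInterval) (Sig : Set V) (x : V) (Y : Set V) (D : List V)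
    (o v : V) (hov : o ≠ v) (hoD : o ∉ D)
    (hY : ∀ e : Sym2 V, ¬ e.IsDiag → (∃ u ∈ e, u ∈ Y) → (w e : ℝ) < 1)
    (hW : ∀ g : Set (Sym2 V) → ℝ, Monotone g → (∀ C, 0 ≤ g C) →
      0 ≤ ∫ ω in {ω : BondConfig V | ∀ y ∈ Y, ¬ (openGraph ω).Reachable x y},
        CSH.cshMarg (mixDecoyList w Sig o (insert x Y) D) (mixObsConst w Sig v (insert x Y ∪ {d | d ∈ D})) o v
          (fun u => if u = o then
              (if (∀ z ∈ Sig, ∀ y ∈ Y, ¬ (openGraph ω).Reachable y z) then (1 : ℝ) else 0) *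
                ((∫ η in {η : BondConfig V | ∃ z ∈ Sig, (openGraph η).Reachable x z}, g (openEdgeCluster η x)
                    ∂(prodBernoulli fun e => if (∃ z ∈ e, ∃ y ∈ Y, (openGraph ω).Reachable y z)
                      then (0 : unitInterval) else w e)) -
                  (∫ η, g (openEdgeCluster η x)
                    ∂(prodBernoulli fun e => if (∃ z ∈ e, ∃ y ∈ Y, (openGraph ω).Reachable y z)
                      then (0 : unitInterval) else w e)) *
                  (prodBernoulli fun e => if (∃ z ∈ e, ∃ y ∈ Y, (openGraph ω).Reachable y z)
                      then (0 : unitInterval) else w e).real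
                    {η : BondConfig V | ∃ z ∈ Sig, (openGraph η).Reachable x z})
            else
              (∫ η in (openConn x u : Set (BondConfig V)), g (openEdgeCluster η x)
                  ∂(prodBernoulli fun e => if (∃ z ∈ e, ∃ y ∈ Y, (openGraph ω).Reachable y z)
                    then (0 : unitInterval) else w e)) -
                (∫ η, g (openEdgeCluster η x)
                  ∂(prodBernoulli fun e => if (∃ z ∈ e, ∃ y ∈ Y, (openGraph ω).Reachable y z)
                    then (0 : unitInterval) else w e)) *
                (prodBernoulli fun e => if (∃ z ∈ e, ∃ y ∈ Y, (openGraph ω).Reachable y z)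
                    then (0 : unitInterval) else w e).real (openConn x u : Set (BondConfig V)))
        ∂(prodBernoulli w))
    (f : Set (Sym2 V) → ℝ) (hf : Monotone f) :
    0 ≤ mixCshMargin w Sig x Y D o v f := by
  classical
  set L := mixDecoyList w Sig o (insert x Y) D with hL
  set p := mixObsConst w Sig v (insert x Y ∪ {d | d ∈ D}) with hp
  set Λ : V → ℝ := fun u => CSH.cshMarg L p o v (Pi.single u 1) with hΛ
  have hLo : ∀ dc ∈ L, dc.1 ≠ o := fun dc hdc h => hoD (h ▸ mem_mixDecoyList w Sig o _ D dc hdc)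
  have hΛo : Λ o = 1 := cshMarg_single_label L p hov hLo
  have hΛo0 : 0 ≤ Λ o := by rw [hΛo]; exact zero_le_one
  -- the margin as `Σ_{u ≠ o} Λ u · covD u + Λ o · (hub covariance)`
  have hconc : mixCshMargin w Sig x Y D o v f =
      (∑ u ∈ Finset.univ.erase o, Λ u * CSH.covD w x Y f u) + Λ o * mixCovD w Sig o x Y f o := by
    rw [mixCshMargin, ← hL, ← hp, CSH.cshMarg_eq_sum, ← Finset.add_sum_erase _ _ (Finset.mem_univ o), add_comm]
    congr 1
    exact Finset.sum_congr rfl fun u hu => by rw [mixCovD_of_ne w Sig (Finset.ne_of_mem_erase hu)]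
  have main := BHK2006_multiMarkerHubCov_nonneg_of_within w x Y hY (Finset.univ.erase o) Λ Sig (Λ o) hΛo0
    (fun g hg hg0 => by
      have h := hW g hg hg0
      have e : ∀ ω : BondConfig V, CSH.cshMarg L p o v
          (fun u => if u = o then
              (if (∀ z ∈ Sig, ∀ y ∈ Y, ¬ (openGraph ω).Reachable y z) then (1 : ℝ) else 0) *
                ((∫ η in {η : BondConfig V | ∃ z ∈ Sig, (openGraph η).Reachable x z}, g (openEdgeCluster η x)
                    ∂(prodBernoulli fun e => if (∃ z ∈ e, ∃ y ∈ Y, (openGraph ω).Reachable y z)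
                      then (0 : unitInterval) else w e)) -
                  (∫ η, g (openEdgeCluster η x)
                    ∂(prodBernoulli fun e => if (∃ z ∈ e, ∃ y ∈ Y, (openGraph ω).Reachable y z)
                      then (0 : unitInterval) else w e)) *
                  (prodBernoulli fun e => if (∃ z ∈ e, ∃ y ∈ Y, (openGraph ω).Reachable y z)
                      then (0 : unitInterval) else w e).real
                    {η : BondConfig V | ∃ z ∈ Sig, (openGraph η).Reachable x z})
            else
              (∫ η in (openConn x u : Set (BondConfig V)), g (openEdgeCluster η x)
                  ∂(prodBernoulli fun e => if (∃ z ∈ e, ∃ y ∈ Y, (openGraph ω).Reachable y z)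
                    then (0 : unitInterval) else w e)) -
                (∫ η, g (openEdgeCluster η x)
                  ∂(prodBernoulli fun e => if (∃ z ∈ e, ∃ y ∈ Y, (openGraph ω).Reachable y z)
                    then (0 : unitInterval) else w e)) *
                (prodBernoulli fun e => if (∃ z ∈ e, ∃ y ∈ Y, (openGraph ω).Reachable y z)
                    then (0 : unitInterval) else w e).real (openConn x u : Set (BondConfig V))) =
        (∑ u ∈ Finset.univ.erase o, Λ u *
            ((∫ η in (openConn x u : Set (BondConfig V)), g (openEdgeCluster η x)
                ∂(prodBernoulli fun e => if (∃ z ∈ e, ∃ y ∈ Y, (openGraph ω).Reachable y z)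
                  then (0 : unitInterval) else w e)) -
              (∫ η, g (openEdgeCluster η x)
                ∂(prodBernoulli fun e => if (∃ z ∈ e, ∃ y ∈ Y, (openGraph ω).Reachable y z)
                  then (0 : unitInterval) else w e)) *
              (prodBernoulli fun e => if (∃ z ∈ e, ∃ y ∈ Y, (openGraph ω).Reachable y z)
                  then (0 : unitInterval) else w e).real (openConn x u : Set (BondConfig V)))) +
          Λ o * ((if (∀ z ∈ Sig, ∀ y ∈ Y, ¬ (openGraph ω).Reachable y z) then (1 : ℝ) else 0) *
            ((∫ η in {η : BondConfig V | ∃ z ∈ Sig, (openGraph η).Reachable x z}, g (openEdgeCluster η x)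
                ∂(prodBernoulli fun e => if (∃ z ∈ e, ∃ y ∈ Y, (openGraph ω).Reachable y z)
                  then (0 : unitInterval) else w e)) -
              (∫ η, g (openEdgeCluster η x)
                ∂(prodBernoulli fun e => if (∃ z ∈ e, ∃ y ∈ Y, (openGraph ω).Reachable y z)
                  then (0 : unitInterval) else w e)) *
              (prodBernoulli fun e => if (∃ z ∈ e, ∃ y ∈ Y, (openGraph ω).Reachable y z)
                  then (0 : unitInterval) else w e).real
                {η : BondConfig V | ∃ z ∈ Sig, (openGraph η).Reachable x z})) := by
        intro ω
        rw [CSH.cshMarg_eq_sum, ← Finset.add_sum_erase _ _ (Finset.mem_univ o), add_comm]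
        congr 1
        · exact Finset.sum_congr rfl fun u hu => by rw [if_neg (Finset.ne_of_mem_erase hu)]
        · rw [if_pos rfl]
      simp only [e] at h
      -- the two sides agree up to the (subsingleton) decidability instances inside the indicators / world weights
      convert h using 12) f hf
  rw [hconc, mixCovD_hub]
  convert main using 12
  all_goals rfl

end MixCSH

end Summit.CriticalPhenomena.PercolationContinuityZ3.Theorems

end
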